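import Literature.AlgebraicGeometry.HodgeTheory.GriffithsHolomorphicHodgeSubbundles
import HarnessLib

/-!
# The Baldi–Klingler–Ullmo finite-monodromy fact from Griffiths' theorem (Voisin I Thm. 10.3)

Family `hodge`, layer `Literature/AlgebraicGeometry/HodgeTheory`; proof file (one theorem, no definition,
no named fact): the tree's named fact `bku_finite_monodromyOrbit_of_isHodgeGenericIn`
(`HodgeGenericQbarDescent`, Baldi–Klingler–Ullmo §3.2) follows from the named fact
`Griffiths1968_holomorphicHodgeSubbundles` (`GriffithsHolomorphicHodgeSubbundles`) by the tree theorem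
`bku_finite_monodromyOrbit_of_isHodgeGenericIn_of_holomorphicHodgeSubbundles` (graded frames, analytic
dichotomy of Hodge loci, Deligne's generic point, André's type stability, finiteness of polarised integral
classes of bounded norm — all proved in the tree).

## References

* [BaldiKlinglerUllmo2024] G. Baldi, B. Klingler, E. Ullmo, On the distribution of the Hodge locus,
  Invent. Math. 235 (2024), §3.2.
* [VoisinHodgeI2002] C. Voisin, Hodge Theory and Complex Algebraic Geometry I, CUP (2002), §10.2.1 Thm. 10.3.
-/

noncomputable section

namespace Literature.AlgebraicGeometry.HodgeTheory

section HodgeTheory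

/-- **The Baldi–Klingler–Ullmo finite-monodromy fact from Griffiths' theorem**: the tree's named fact
`bku_finite_monodromyOrbit_of_isHodgeGenericIn` follows from `Griffiths1968_holomorphicHodgeSubbundles`
by `bku_finite_monodromyOrbit_of_isHodgeGenericIn_of_holomorphicHodgeSubbundles` (graded frames, the
analytic dichotomy of Hodge loci, Deligne's generic point, André's type stability and the finiteness of
polarised integral classes of bounded norm are proved in the tree).
[cite: BaldiKlinglerUllmo2024, §3.2] [cite: VoisinHodgeI2002, §10.2.1 Thm. 10.3] -/
theorem bku_finite_monodromyOrbit_of_isHodgeGenericIn_of_griffiths1968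
    (hG : Griffiths1968_holomorphicHodgeSubbundles) : bku_finite_monodromyOrbit_of_isHodgeGenericIn := by
  refine bku_finite_monodromyOrbit_of_isHodgeGenericIn_of_holomorphicHodgeSubbundles ?_
  intro _ 𝒳 S f n k d hf hS _ hU A hA _ s t₁ N hN
  obtain ⟨W, hWo, ht₁W, hWN, hWpc, ψ, hWψ, hW⟩ := hG f n k d hf hS hU A hA s t₁ N hN
  exact ⟨W, hWo, ht₁W, hWN, hWpc, d, ψ, hWψ, hW⟩

end HodgeTheory

end Literature.AlgebraicGeometry.HodgeTheory

end
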